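import Summits.AtomisticToContinuum.FouriersLaw.Theses.HonestZwanzig
import Summits.AtomisticToContinuum.FouriersLaw.Theorems.HonestZwanzigNetworkReductionLimits
import Summits.AtomisticToContinuum.FouriersLaw.Theorems.HonestZwanzigGeneratorSiteEnergy
import Summits.AtomisticToContinuum.FouriersLaw.Theorems.HonestZwanzigParityStatics

/-!
# HonestZwanzig / PositiveMemory — Feshbach duality (stub S1 of line `Sketch`)

Support file for item `stmt-AtomisticToContinuum-12694` (`PositiveMemory` of route `HonestZwanzig`,
sub-problem `FouriersLaw`). At fixed `N ≥ 2` and Laplace variable `s > 0` the Feshbach matrix of the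
route, `𝔽(s)_{xy} = s·cov(e_x,e_y) − cov(e_x, L e_y) − schur_s((L e_x)∘Θ, L e_y)`, equals
`χ G(s)⁻¹ χ` with `χ_{xy} = cov(e_x,e_y)` and `G(s)_{xy} = lap_s(e_x,e_y)` (Kolmogorov identities, time
reversal and the symmetry of `cov(e_x, L e_y)`; this is step (4) of `circuit_sandwich` in
`…NetworkReductionCircuit`). Since `G(s)` is symmetric positive definite, Cauchy–Schwarz in the
`G(s)`-inner product gives, for all site profiles `a, ζ`,
`(Σ_x Σ_y a_x cov(e_x,e_y) ζ_y)² ≤ (aᵀG(s)a)·(ζᵀ𝔽(s)ζ)`.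
Three layers, exactly as in the `NetworkReduction` files: an abstract linear-algebra lemma
(`duality_abstract`), its instance for the canonical objects of the route from the fixed-`N` package
`FeshbachIdentities` (`fixedN_duality`, discharging the hypotheses by `pkg_G_symm`, `pkg_K1`–`pkg_K3`),
and the registered stub `stub_feshbachDuality`.
-/

noncomputable section

open MeasureTheory Finset Real Set Filter Matrix
open Literature.MathematicalPhysics.KineticTheory.HeatConduction
open Summit.AtomisticToContinuum.FouriersLaw.Theorems.HonestZwanzig.NetworkReduction

namespace Summit.AtomisticToContinuum.FouriersLaw.Theorems.HonestZwanzig.PositiveMemory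

/-! ### Cauchy–Schwarz for a positive semidefinite real matrix -/

-- adapted from Prior …Pnp_NegHardCoreUniquenessThreshold_HcutRearrangement `Hcut.dotProduct_mulVec_sq_le`
/-- Cauchy–Schwarz for the semi-inner product `⟨a, w⟩_M = a ⬝ᵥ M *ᵥ w` of a real symmetric matrix with
nonnegative quadratic form: `(aᵀMw)² ≤ (aᵀMa)(wᵀMw)`. -/
theorem dotProduct_mulVec_sq_le {n : Type*} [Fintype n] (M : Matrix n n ℝ)
    (hsymm : ∀ x y, M x y = M y x) (hpos : ∀ v : n → ℝ, 0 ≤ v ⬝ᵥ (M *ᵥ v)) (a w : n → ℝ) :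
    (a ⬝ᵥ (M *ᵥ w)) ^ 2 ≤ (a ⬝ᵥ (M *ᵥ a)) * (w ⬝ᵥ (M *ᵥ w)) := by
  have hsw : w ⬝ᵥ (M *ᵥ a) = a ⬝ᵥ (M *ᵥ w) := by
    rw [dotProduct_mulVec_of_symm M hsymm, dotProduct_comm]
  have key : ∀ t : ℝ,
      0 ≤ (w ⬝ᵥ (M *ᵥ w)) * (t * t) + (2 * (a ⬝ᵥ (M *ᵥ w))) * t + a ⬝ᵥ (M *ᵥ a) := by
    intro t
    have h0 := hpos (a + t • w)
    have hexp : (a + t • w) ⬝ᵥ (M *ᵥ (a + t • w)) =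
        (w ⬝ᵥ (M *ᵥ w)) * (t * t) + (2 * (a ⬝ᵥ (M *ᵥ w))) * t + a ⬝ᵥ (M *ᵥ a) := by
      rw [Matrix.mulVec_add, Matrix.mulVec_smul, dotProduct_add, add_dotProduct, add_dotProduct,
        dotProduct_smul, dotProduct_smul, smul_dotProduct, smul_dotProduct, hsw]
      simp only [smul_eq_mul]
      ring
    rwa [hexp] at h0
  have hd := discrim_le_zero key
  rw [discrim] at hd
  nlinarith [hd]

/-! ### The abstract duality (pairings at one fixed `s`) -/

/-- **Feshbach duality, abstract form.** For abstract pairings `lap, cov` and observables `e x`,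
`Lf y` (`L e_y`), `Lr y` (`(L e_y)∘Θ`) satisfying the fixed-`s` identities of the Feshbach block algebra
(symmetry and positivity of `G = [lap(e_x,e_y)]`, symmetry of `cov(e_x,e_y)`, the three Kolmogorov
identities), the matrix `𝔽_{xy} = s·cov(e_x,e_y) − cov(e_x, Lf y) − schur(Lr x, Lf y)` equals `C G⁻¹ C`
(`C = [cov(e_x,e_y)]`), whence `(aᵀCζ)² ≤ (aᵀGa)(ζᵀ𝔽ζ)` by Cauchy–Schwarz in the `G`-metric. -/
theorem duality_abstract {X : Type*} {N : ℕ}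
    (lap cov schur : (X → ℝ) → (X → ℝ) → ℝ) (e Lf Lr : Fin N → X → ℝ)
    (G C : Matrix (Fin N) (Fin N) ℝ) (F : Fin N → Fin N → ℝ) (s : ℝ)
    (hG : ∀ x y, G x y = lap (e x) (e y)) (hC : ∀ x y, C x y = cov (e x) (e y))
    (hschur : ∀ f g, schur f g = lap f g - ∑ x, ∑ y, lap f (e x) * G⁻¹ x y * lap (e y) g)
    (hF : ∀ x y, F x y = s * cov (e x) (e y) - cov (e x) (Lf y) - schur (Lr x) (Lf y))
    (hGs : ∀ x y, lap (e x) (e y) = lap (e y) (e x))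
    (hGp : ∀ v : Fin N → ℝ, v ≠ 0 → 0 < ∑ x, ∑ y, v x * G x y * v y)
    (hCs : ∀ x y, cov (e x) (e y) = cov (e y) (e x))
    (hK1 : ∀ x u, lap (Lr x) (e u) = s * lap (e x) (e u) - cov (e x) (e u))
    (hK2 : ∀ u y, lap (e u) (Lf y) = s * lap (e u) (e y) - cov (e u) (e y))
    (hK3 : ∀ x y, lap (Lr x) (Lf y) = s * (s * lap (e x) (e y) - cov (e x) (e y)) - cov (e x) (Lf y))
    (a ζ : Fin N → ℝ) :
    (∑ x, ∑ y, a x * cov (e x) (e y) * ζ y) ^ 2 ≤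
      (∑ x, ∑ y, a x * G x y * a y) * (∑ x, ∑ y, ζ x * F x y * ζ y) := by
  -- the Gram matrix `G` is positive definite, hence invertible
  have hGsym : ∀ x y, G x y = G y x := fun x y => by rw [hG, hG, hGs]
  have hCsym : ∀ x y, C x y = C y x := fun x y => by rw [hC, hC, hCs]
  have hGpd : G.PosDef := posDef_of_symm_of_pos G hGsym hGp
  have hGu : IsUnit G.det := (Matrix.isUnit_iff_isUnit_det G).1 hGpd.isUnit
  have hGG : G * G⁻¹ = 1 := Matrix.mul_nonsing_inv G hGu
  have hGG' : G⁻¹ * G = 1 := Matrix.nonsing_inv_mul G hGu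
  -- 𝔽 = C G⁻¹ C entrywise (adapted from `circuit_sandwich`, step (4))
  have h4 : ∀ x y, F x y = (C * G⁻¹ * C) x y := by
    intro x y
    rw [hF, hschur, hK3]
    have hT : ∀ u v, lap (Lr x) (e u) * G⁻¹ u v * lap (e v) (Lf y) =
        (s • G - C) x u * G⁻¹ u v * (s • G - C) v y := by
      intro u v
      rw [hK1, hK2]
      simp only [Matrix.sub_apply, Matrix.smul_apply, smul_eq_mul, hG, hC]
    have hT' : ∑ u, ∑ v, lap (Lr x) (e u) * G⁻¹ u v * lap (e v) (Lf y) =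
        ((s • G - C) * G⁻¹ * (s • G - C)) x y := by
      rw [mul_mul_apply_eq_sum_sum]
      exact Finset.sum_congr rfl fun u _ => Finset.sum_congr rfl fun v _ => hT u v
    rw [hT']
    have hmat : (s • G - C) * G⁻¹ * (s • G - C) =
        (s * s) • G - s • C - s • C + C * G⁻¹ * C := by
      have e1 : (s • G - C) * G⁻¹ = s • (1 : Matrix (Fin N) (Fin N) ℝ) - C * G⁻¹ := by
        rw [sub_mul, Matrix.smul_mul, hGG]
      rw [e1, sub_mul, mul_sub, mul_sub, Matrix.smul_mul, Matrix.smul_mul, Matrix.one_mul,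
        Matrix.one_mul, smul_smul, Matrix.mul_smul, Matrix.mul_assoc C G⁻¹ G, hGG', Matrix.mul_one]
      abel
    rw [hmat]
    simp only [Matrix.add_apply, Matrix.sub_apply, Matrix.smul_apply, smul_eq_mul]
    rw [hG x y, hC x y]
    ring
  -- the three quadratic forms in the `G`-metric, with `w = G⁻¹ C ζ`, `G w = C ζ`
  have hGw : G *ᵥ (G⁻¹ *ᵥ (C *ᵥ ζ)) = C *ᵥ ζ := by
    rw [Matrix.mulVec_mulVec, hGG, Matrix.one_mulVec]
  have hlhs : ∑ x, ∑ y, a x * cov (e x) (e y) * ζ y = a ⬝ᵥ (G *ᵥ (G⁻¹ *ᵥ (C *ᵥ ζ))) := by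
    rw [hGw, ← sum_sum_eq_dotProduct_mulVec]
    exact Finset.sum_congr rfl fun x _ => Finset.sum_congr rfl fun y _ => by rw [hC]
  have hGa : ∑ x, ∑ y, a x * G x y * a y = a ⬝ᵥ (G *ᵥ a) := sum_sum_eq_dotProduct_mulVec G a a
  have hquad : ∑ x, ∑ y, ζ x * F x y * ζ y =
      (G⁻¹ *ᵥ (C *ᵥ ζ)) ⬝ᵥ (G *ᵥ (G⁻¹ *ᵥ (C *ᵥ ζ))) := by
    have : ∑ x, ∑ y, ζ x * F x y * ζ y = ∑ x, ∑ y, ζ x * (C * G⁻¹ * C) x y * ζ y :=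
      Finset.sum_congr rfl fun x _ => Finset.sum_congr rfl fun y _ => by rw [h4]
    rw [this, sum_sum_eq_dotProduct_mulVec, ← Matrix.mulVec_mulVec, ← Matrix.mulVec_mulVec,
      dotProduct_mulVec_of_symm C hCsym, hGw, dotProduct_comm]
  have hpsd : ∀ v : Fin N → ℝ, 0 ≤ v ⬝ᵥ (G *ᵥ v) := fun v => by
    have := hGpd.posSemidef.dotProduct_mulVec_nonneg v
    rwa [star_trivial] at this
  rw [hlhs, hGa, hquad]
  exact dotProduct_mulVec_sq_le G hGsym hpsd a _

/-! ### The canonical objects: discharging the hypotheses from `FeshbachIdentities` -/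

section Package

variable {ω₂ lam β γ : ℝ} {N : ℕ} {T : ℝ}
  {Adm : (PhaseSpace N → ℝ) → Prop}
  {corr : (PhaseSpace N → ℝ) → (PhaseSpace N → ℝ) → ℝ → ℝ}
  {lap : ℝ → (PhaseSpace N → ℝ) → (PhaseSpace N → ℝ) → ℝ}
  {cov : (PhaseSpace N → ℝ) → (PhaseSpace N → ℝ) → ℝ}
  {e : Fin N → PhaseSpace N → ℝ}
  (hAdm : ∀ f, Adm f ↔ (Continuous f ∧ ∃ A : ℝ, ∀ z,
    |f z| ≤ A * Real.exp ((pinnedChain ω₂ lam β γ).hamiltonian N z / (8 * T))))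
  (hlap : ∀ s f g, lap s f g = ∫ t in Set.Ioi (0 : ℝ), Real.exp (-(s * t)) * corr f g t)
  (hcov : ∀ f g, cov f g = (∫ z, f z * g z ∂(pinnedChain ω₂ lam β γ).gibbsMeasure N T) -
    (∫ z, f z ∂(pinnedChain ω₂ lam β γ).gibbsMeasure N T) *
      (∫ z, g z ∂(pinnedChain ω₂ lam β γ).gibbsMeasure N T))
  (he : ∀ x z, e x z = z.2 x ^ 2 / 2 + (pinnedChain ω₂ lam β γ).U (z.1 x) +
    ∑ j : Fin N, ((if j.val = x.val + 1 then (pinnedChain ω₂ lam β γ).V (z.1 j - z.1 x) / 2 else 0) +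
      (if x.val = j.val + 1 then (pinnedChain ω₂ lam β γ).V (z.1 x - z.1 j) / 2 else 0)))
  (hFI : ∀ f g : PhaseSpace N → ℝ, Adm f → Adm g →
    Integrable f ((pinnedChain ω₂ lam β γ).gibbsMeasure N T) ∧
    (∀ t : ℝ, 0 ≤ t → Integrable (fun z => f z *
      (∫ y, g y ∂((pinnedChain ω₂ lam β γ).transitionKernel N T T t.toNNReal z)))
      ((pinnedChain ω₂ lam β γ).gibbsMeasure N T)) ∧
    IntegrableOn (corr f g) (Set.Ioi 0) ∧
    (∀ t : ℝ, 0 ≤ t → corr f g t = corr (fun z => g (z.1, -z.2)) (fun z => f (z.1, -z.2)) t) ∧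
    (∀ s : ℝ, 0 < s → ∀ x : Fin N,
      s * lap s (e x) g - cov (e x) g =
        lap s (fun z => (pinnedChain ω₂ lam β γ).generator N T T (e x) (z.1, -z.2)) g ∧
      s * lap s f (e x) - cov f (e x) = lap s f ((pinnedChain ω₂ lam β γ).generator N T T (e x))))
  (hGSE : ∀ (x : Fin N) (z : PhaseSpace N), (pinnedChain ω₂ lam β γ).generator N T T (e x) z =
    (∑ b : Fin N, ((if x.val = b.val + 1 then (pinnedChain ω₂ lam β γ).bondCurrent N b z else 0) -
      (if b = x then (pinnedChain ω₂ lam β γ).bondCurrent N b z else 0))) +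
    (if x.val = 0 then (pinnedChain ω₂ lam β γ).γ * (T - z.2 x ^ 2) else 0) +
    (if x.val = N - 1 then (pinnedChain ω₂ lam β γ).γ * (T - z.2 x ^ 2) else 0))
  (hPS : ∀ x y : Fin N, cov (e x) ((pinnedChain ω₂ lam β γ).generator N T T (e y)) =
    -(if x = y ∧ (x.val = 0 ∨ x.val = N - 1) then (pinnedChain ω₂ lam β γ).γ * T ^ 2 else 0))
  (hω : 0 < ω₂) (hl : 0 ≤ lam) (hβ : 0 ≤ β) (hT : 0 < T)

include hAdm hlap hcov hFI he hGSE hPS hω hl hβ hT in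
/-- **Feshbach duality at fixed `N` and `s > 0` for the canonical objects.** With
`G = [lap_s(e_x,e_y)]` positive definite and the Feshbach matrix
`𝔽_{xy} = s·cov(e_x,e_y) − cov(e_x, L e_y) − schur_s((L e_x)∘Θ, L e_y)`:
`(Σ_x Σ_y a_x cov(e_x,e_y) ζ_y)² ≤ (aᵀGa)(ζᵀ𝔽ζ)` for all profiles `a, ζ`. -/
theorem fixedN_duality {s : ℝ} (hs : 0 < s)
    (G : Matrix (Fin N) (Fin N) ℝ) (hG : ∀ x y, G x y = lap s (e x) (e y))
    (schur : (PhaseSpace N → ℝ) → (PhaseSpace N → ℝ) → ℝ)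
    (hschur : ∀ f g, schur f g = lap s f g - ∑ x, ∑ y, lap s f (e x) * G⁻¹ x y * lap s (e y) g)
    (F : Fin N → Fin N → ℝ)
    (hF : ∀ x y, F x y = s * cov (e x) (e y) - cov (e x) ((pinnedChain ω₂ lam β γ).generator N T T (e y)) -
      schur (fun z => (pinnedChain ω₂ lam β γ).generator N T T (e x) (z.1, -z.2))
        ((pinnedChain ω₂ lam β γ).generator N T T (e y)))
    (hGp : ∀ v : Fin N → ℝ, v ≠ 0 → 0 < ∑ x, ∑ y, v x * G x y * v y)
    (a ζ : Fin N → ℝ) :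
    (∑ x, ∑ y, a x * cov (e x) (e y) * ζ y) ^ 2 ≤
      (∑ x, ∑ y, a x * G x y * a y) * (∑ x, ∑ y, ζ x * F x y * ζ y) :=
  duality_abstract (lap s) cov schur e (fun y => (pinnedChain ω₂ lam β γ).generator N T T (e y))
    (fun y z => (pinnedChain ω₂ lam β γ).generator N T T (e y) (z.1, -z.2))
    G (Matrix.of fun x y => cov (e x) (e y)) F s hG (fun _ _ => rfl) hschur hF
    (pkg_G_symm hAdm hlap he hFI hω hl hβ hT s) hGp (fun x y => cov_comm hcov (e x) (e y))
    (pkg_K1 hAdm he hFI hω hl hβ hT hs) (pkg_K2 hAdm he hFI hω hl hβ hT hs)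
    (pkg_K3 hAdm hlap hcov he hFI hGSE hPS hω hl hβ hT hs) a ζ

end Package

/-! ### The registered stub -/

/-- **Stub S1 — Feshbach duality** (fixed `N`, `s > 0`; linear algebra over `FeshbachIdentities`): with
`χ_{xy} = cov(e_x,e_y)`, `G(s)_{xy} = lap_s(e_x,e_y)` and the Feshbach matrix `𝔽(s)` of `RobinCoercivity`,
`𝔽 = χG⁻¹χ` (Kolmogorov identities + time reversal) and `G(s) ≻ 0`, hence Cauchy–Schwarz in the
`G(s)`-inner product: `(aᵀχζ)² ≤ (aᵀG(s)a)(ζᵀ𝔽(s)ζ)` for all site profiles `a, ζ`. -/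
theorem stub_feshbachDuality :
    Summit.AtomisticToContinuum.FouriersLaw.Theses.HonestZwanzig.FeshbachIdentities →
    ∀ ω₂ lam β γ : ℝ, 0 < ω₂ → 0 < lam → 0 < β → 0 < γ → ∀ T : ℝ, 0 < T → ∀ N : ℕ, 2 ≤ N →
    let P := Literature.MathematicalPhysics.KineticTheory.HeatConduction.pinnedChain ω₂ lam β γ;
    let X := Literature.MathematicalPhysics.KineticTheory.HeatConduction.PhaseSpace N;
    let μ : MeasureTheory.Measure X := P.gibbsMeasure N T;
    let corr : (X → ℝ) → (X → ℝ) → ℝ → ℝ := fun f g t =>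
      (∫ z, f z * (∫ y, g y ∂(P.transitionKernel N T T t.toNNReal z)) ∂μ) - (∫ z, f z ∂μ) * (∫ z, g z ∂μ);
    let lap : ℝ → (X → ℝ) → (X → ℝ) → ℝ := fun s f g =>
      ∫ t in Set.Ioi (0 : ℝ), Real.exp (-(s * t)) * corr f g t;
    let cov : (X → ℝ) → (X → ℝ) → ℝ := fun f g => (∫ z, f z * g z ∂μ) - (∫ z, f z ∂μ) * (∫ z, g z ∂μ);
    let e : Fin N → X → ℝ := fun x z => z.2 x ^ 2 / 2 + P.U (z.1 x) +
      ∑ j : Fin N, ((if j.val = x.val + 1 then P.V (z.1 j - z.1 x) / 2 else 0) +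
        (if x.val = j.val + 1 then P.V (z.1 x - z.1 j) / 2 else 0));
    let G : ℝ → Matrix (Fin N) (Fin N) ℝ := fun s => Matrix.of fun x y => lap s (e x) (e y);
    let schur : ℝ → (X → ℝ) → (X → ℝ) → ℝ := fun s f g =>
      lap s f g - ∑ x : Fin N, ∑ y : Fin N, lap s f (e x) * (G s)⁻¹ x y * lap s (e y) g;
    let F : ℝ → Fin N → Fin N → ℝ := fun s x y => s * cov (e x) (e y) - cov (e x) (P.generator N T T (e y)) -
      schur s (fun z => P.generator N T T (e x) (z.1, -z.2)) (P.generator N T T (e y));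
    ∀ s : ℝ, 0 < s → ∀ a ζ : Fin N → ℝ,
      (∑ x : Fin N, ∑ y : Fin N, a x * cov (e x) (e y) * ζ y) ^ 2 ≤
        (∑ x : Fin N, ∑ y : Fin N, a x * G s x y * a y) * (∑ x : Fin N, ∑ y : Fin N, ζ x * F s x y * ζ y) := by
  intro hFI ω₂ lam β γ hω hl hβ hγ T hT N hN
  obtain ⟨-, hFI2, -, hGp⟩ := hFI ω₂ lam β γ hω hl hβ hγ T hT N hN
  intro P X μ corr lap cov e G schur F s hs a ζ
  exact fixedN_duality (ω₂ := ω₂) (lam := lam) (β := β) (γ := γ) (N := N) (T := T)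
    (fun f => Iff.rfl) (fun s f g => rfl) (fun f g => rfl) (fun x z => rfl) hFI2
    (fun x z => generatorSiteEnergy_proof ω₂ lam β γ N hN T T x z)
    (fun x y => ((parityStatics_proof ω₂ lam β γ hω hl hβ hγ T hT N hN) x).2 y)
    hω hl.le hβ.le hT hs (G s) (fun x y => rfl) (schur s) (fun f g => rfl) (F s) (fun x y => rfl)
    (hGp s hs) a ζ

end Summit.AtomisticToContinuum.FouriersLaw.Theorems.HonestZwanzig.PositiveMemory

end
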